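import Mathlib
import Summits.Ventures.DiscreteObjects.Mahler.CensusKernelDeg12B
import Summits.Ventures.DiscreteObjects.Mahler.CensusKernelDeg12C
import Summits.Ventures.DiscreteObjects.Mahler.CensusKernelDeg12D
import Summits.Ventures.DiscreteObjects.Mahler.CensusKernelDeg12E
import Summits.Ventures.DiscreteObjects.Mahler.CensusKernelDeg12F
import Summits.Ventures.DiscreteObjects.Mahler.CensusKernelDeg12G
import Summits.Ventures.DiscreteObjects.Mahler.CensusKernelDeg12H
import Summits.Ventures.DiscreteObjects.Mahler.CensusKernelDeg12I
import Summits.Ventures.DiscreteObjects.Mahler.CensusKernelDeg12J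
import Summits.Ventures.DiscreteObjects.Mahler.CensusKernelDeg12K
import Summits.Ventures.DiscreteObjects.Mahler.CensusKernelDeg12L
import Summits.Ventures.DiscreteObjects.Mahler.CensusKernelDeg12M
import Summits.Ventures.DiscreteObjects.Mahler.CensusKernelDeg12N
import Summits.Ventures.DiscreteObjects.Mahler.CensusKernelDeg12O
import Summits.Ventures.DiscreteObjects.Mahler.CensusKernelDeg12P
import Summits.Ventures.DiscreteObjects.Mahler.CensusKernelDeg12Q
import Summits.Ventures.DiscreteObjects.Mahler.CensusKernelDeg12R
import Summits.Ventures.DiscreteObjects.Mahler.CensusKernelDeg12S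

/-!
# Kernel census, degree 12 (part T, assembly): every irreducible integer polynomial of degree 12 with `1 < M < 13/10` is one of the 5 census cores

Cell `pub-namedobj`, seat `pub-namedobj-mahler-g12`. Framing: lottery ticket; floor = certified bounds/negative
ranges.

`DegreeCensus 12 (13/10) coresDeg12` as a THEOREM of the Lean kernel (standard axioms; `decide` with kernel reduction, no
`native_decide`). By the `x ↦ -x` symmetry (`CensusHalfSearch`) only the half `c₁ ≥ 0` of the search `censusSearch T12 6 []`
(493695 leaves in all, 1933 survivors of the 24 power-sum tests) is run. Parts A, B: thresholds `T12` and the first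
chunk checks. Parts C onward: for each node `(c₁, c₂, c₃)` (≤ 252 leaves) its own kernel check — one theorem each, so that every
evaluation runs under the default per-command heartbeat budget — and for each node `(c₁, c₂)` a lemma "every survivor below it
carries a valid certificate" by case split on `c₃`. The last part imports them all, assembles `certified12` and proves
`degreeCensus_twelve`. This re-derives, inside the kernel, the degree-12 slice of the published complete lists (Boyd 1980;
Mossinghoff 1998; Mossinghoff–Rhin–Wu 2008 to degree 44): 5 polynomials up to `±x` — a CONTROL/replication row, not new ground.
-/

namespace Summit.Ventures.DiscreteObjects.Mahler

open Polynomial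

/-- Every survivor with `c₁ ≥ 0` of the degree-12 search is certified. -/
theorem certified12 : ∀ a ∈ censusSearch T12 6 [], 0 ≤ a.getD 0 0 →
    ∃ c, checkCert 13 10 12 coresDeg12 (1 :: palC a) c = true := by
  intro a ha hsign
  rw [mem_censusSearch_succ_iff, (by decide : nodeLo T12 [] = -12), (by decide : nodeHi T12 [] = 12)] at ha
  obtain ⟨a1, ha1, ha⟩ := ha
  simp only [List.nil_append] at ha
  rw [getD_zero_of_mem_censusSearch_cons ha] at hsign
  rw [mem_icc] at ha1
  obtain ⟨hlo1, hhi1⟩ := ha1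
  interval_cases a1
  · rw [mem_censusSearch_succ_iff, (by decide : nodeLo T12 [0] = -6),
      (by decide : nodeHi T12 [0] = 6)] at ha
    obtain ⟨a2, ha2, ha⟩ := ha
    simp only [List.cons_append, List.nil_append] at ha
    rw [mem_icc] at ha2
    obtain ⟨hlo2, hhi2⟩ := ha2
    interval_cases a2
    · exact exists_cert_of_allCertified _ _ certified12_p0_m6 a ha
    · exact exists_cert_of_allCertified _ _ certified12_p0_m5 a ha
    · exact exists_cert_of_allCertified _ _ certified12_p0_m4 a ha
    · exact exists_cert_of_allCertified _ _ certified12_p0_m3 a ha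
    · exact exists_cert_of_allCertified _ _ certified12_p0_m2 a ha
    · exact exists_cert_of_allCertified _ _ certified12_p0_m1 a ha
    · exact certified12_p0_p0 a ha
    · exact certified12_p0_p1 a ha
    · exact exists_cert_of_allCertified _ _ certified12_p0_p2 a ha
    · exact exists_cert_of_allCertified _ _ certified12_p0_p3 a ha
    · exact exists_cert_of_allCertified _ _ certified12_p0_p4 a ha
    · exact exists_cert_of_allCertified _ _ certified12_p0_p5 a ha
    · exact exists_cert_of_allCertified _ _ certified12_p0_p6 a ha
  · rw [mem_censusSearch_succ_iff, (by decide : nodeLo T12 [1] = -5),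
      (by decide : nodeHi T12 [1] = 6)] at ha
    obtain ⟨a2, ha2, ha⟩ := ha
    simp only [List.cons_append, List.nil_append] at ha
    rw [mem_icc] at ha2
    obtain ⟨hlo2, hhi2⟩ := ha2
    interval_cases a2
    · exact exists_cert_of_allCertified _ _ certified12_p1_m5 a ha
    · exact exists_cert_of_allCertified _ _ certified12_p1_m4 a ha
    · exact exists_cert_of_allCertified _ _ certified12_p1_m3 a ha
    · exact exists_cert_of_allCertified _ _ certified12_p1_m2 a ha
    · exact exists_cert_of_allCertified _ _ certified12_p1_m1 a ha
    · exact certified12_p1_p0 a ha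
    · exact certified12_p1_p1 a ha
    · exact certified12_p1_p2 a ha
    · exact certified12_p1_p3 a ha
    · exact certified12_p1_p4 a ha
    · exact certified12_p1_p5 a ha
    · exact certified12_p1_p6 a ha
  · rw [mem_censusSearch_succ_iff, (by decide : nodeLo T12 [2] = -4),
      (by decide : nodeHi T12 [2] = 8)] at ha
    obtain ⟨a2, ha2, ha⟩ := ha
    simp only [List.cons_append, List.nil_append] at ha
    rw [mem_icc] at ha2
    obtain ⟨hlo2, hhi2⟩ := ha2
    interval_cases a2
    · exact certified12_p2_m4 a ha
    · exact certified12_p2_m3 a ha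
    · exact certified12_p2_m2 a ha
    · exact certified12_p2_m1 a ha
    · exact certified12_p2_p0 a ha
    · exact certified12_p2_p1 a ha
    · exact certified12_p2_p2 a ha
    · exact certified12_p2_p3 a ha
    · exact certified12_p2_p4 a ha
    · exact certified12_p2_p5 a ha
    · exact certified12_p2_p6 a ha
    · exact certified12_p2_p7 a ha
    · exact certified12_p2_p8 a ha
  · rw [mem_censusSearch_succ_iff, (by decide : nodeLo T12 [3] = -1),
      (by decide : nodeHi T12 [3] = 10)] at ha
    obtain ⟨a2, ha2, ha⟩ := ha
    simp only [List.cons_append, List.nil_append] at ha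
    rw [mem_icc] at ha2
    obtain ⟨hlo2, hhi2⟩ := ha2
    interval_cases a2
    · exact certified12_p3_m1 a ha
    · exact certified12_p3_p0 a ha
    · exact certified12_p3_p1 a ha
    · exact certified12_p3_p2 a ha
    · exact certified12_p3_p3 a ha
    · exact certified12_p3_p4 a ha
    · exact certified12_p3_p5 a ha
    · exact certified12_p3_p6 a ha
    · exact certified12_p3_p7 a ha
    · exact certified12_p3_p8 a ha
    · exact certified12_p3_p9 a ha
    · exact certified12_p3_p10 a ha
  · rw [mem_censusSearch_succ_iff, (by decide : nodeLo T12 [4] = 2),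
      (by decide : nodeHi T12 [4] = 14)] at ha
    obtain ⟨a2, ha2, ha⟩ := ha
    simp only [List.cons_append, List.nil_append] at ha
    rw [mem_icc] at ha2
    obtain ⟨hlo2, hhi2⟩ := ha2
    interval_cases a2
    · exact certified12_p4_p2 a ha
    · exact certified12_p4_p3 a ha
    · exact certified12_p4_p4 a ha
    · exact certified12_p4_p5 a ha
    · exact certified12_p4_p6 a ha
    · exact certified12_p4_p7 a ha
    · exact certified12_p4_p8 a ha
    · exact certified12_p4_p9 a ha
    · exact certified12_p4_p10 a ha
    · exact certified12_p4_p11 a ha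
    · exact certified12_p4_p12 a ha
    · exact certified12_p4_p13 a ha
    · exact certified12_p4_p14 a ha
  · rw [mem_censusSearch_succ_iff, (by decide : nodeLo T12 [5] = 7),
      (by decide : nodeHi T12 [5] = 18)] at ha
    obtain ⟨a2, ha2, ha⟩ := ha
    simp only [List.cons_append, List.nil_append] at ha
    rw [mem_icc] at ha2
    obtain ⟨hlo2, hhi2⟩ := ha2
    interval_cases a2
    · exact certified12_p5_p7 a ha
    · exact certified12_p5_p8 a ha
    · exact certified12_p5_p9 a ha
    · exact certified12_p5_p10 a ha
    · exact certified12_p5_p11 a ha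
    · exact certified12_p5_p12 a ha
    · exact certified12_p5_p13 a ha
    · exact certified12_p5_p14 a ha
    · exact certified12_p5_p15 a ha
    · exact certified12_p5_p16 a ha
    · exact certified12_p5_p17 a ha
    · exact certified12_p5_p18 a ha
  · rw [mem_censusSearch_succ_iff, (by decide : nodeLo T12 [6] = 12),
      (by decide : nodeHi T12 [6] = 24)] at ha
    obtain ⟨a2, ha2, ha⟩ := ha
    simp only [List.cons_append, List.nil_append] at ha
    rw [mem_icc] at ha2
    obtain ⟨hlo2, hhi2⟩ := ha2
    interval_cases a2
    · exact certified12_p6_p12 a ha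
    · exact certified12_p6_p13 a ha
    · exact certified12_p6_p14 a ha
    · exact certified12_p6_p15 a ha
    · exact certified12_p6_p16 a ha
    · exact certified12_p6_p17 a ha
    · exact certified12_p6_p18 a ha
    · exact certified12_p6_p19 a ha
    · exact certified12_p6_p20 a ha
    · exact certified12_p6_p21 a ha
    · exact certified12_p6_p22 a ha
    · exact certified12_p6_p23 a ha
    · exact certified12_p6_p24 a ha
  · rw [mem_censusSearch_succ_iff, (by decide : nodeLo T12 [7] = 19),
      (by decide : nodeHi T12 [7] = 30)] at ha
    obtain ⟨a2, ha2, ha⟩ := ha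
    simp only [List.cons_append, List.nil_append] at ha
    rw [mem_icc] at ha2
    obtain ⟨hlo2, hhi2⟩ := ha2
    interval_cases a2
    · exact certified12_p7_p19 a ha
    · exact certified12_p7_p20 a ha
    · exact certified12_p7_p21 a ha
    · exact certified12_p7_p22 a ha
    · exact certified12_p7_p23 a ha
    · exact certified12_p7_p24 a ha
    · exact certified12_p7_p25 a ha
    · exact certified12_p7_p26 a ha
    · exact certified12_p7_p27 a ha
    · exact certified12_p7_p28 a ha
    · exact certified12_p7_p29 a ha
    · exact certified12_p7_p30 a ha
  · rw [mem_censusSearch_succ_iff, (by decide : nodeLo T12 [8] = 26),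
      (by decide : nodeHi T12 [8] = 38)] at ha
    obtain ⟨a2, ha2, ha⟩ := ha
    simp only [List.cons_append, List.nil_append] at ha
    rw [mem_icc] at ha2
    obtain ⟨hlo2, hhi2⟩ := ha2
    interval_cases a2
    · exact certified12_p8_p26 a ha
    · exact certified12_p8_p27 a ha
    · exact certified12_p8_p28 a ha
    · exact certified12_p8_p29 a ha
    · exact certified12_p8_p30 a ha
    · exact certified12_p8_p31 a ha
    · exact certified12_p8_p32 a ha
    · exact certified12_p8_p33 a ha
    · exact certified12_p8_p34 a ha
    · exact certified12_p8_p35 a ha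
    · exact certified12_p8_p36 a ha
    · exact certified12_p8_p37 a ha
    · exact certified12_p8_p38 a ha
  · rw [mem_censusSearch_succ_iff, (by decide : nodeLo T12 [9] = 35),
      (by decide : nodeHi T12 [9] = 46)] at ha
    obtain ⟨a2, ha2, ha⟩ := ha
    simp only [List.cons_append, List.nil_append] at ha
    rw [mem_icc] at ha2
    obtain ⟨hlo2, hhi2⟩ := ha2
    interval_cases a2
    · exact certified12_p9_p35 a ha
    · exact certified12_p9_p36 a ha
    · exact certified12_p9_p37 a ha
    · exact certified12_p9_p38 a ha
    · exact certified12_p9_p39 a ha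
    · exact certified12_p9_p40 a ha
    · exact certified12_p9_p41 a ha
    · exact certified12_p9_p42 a ha
    · exact certified12_p9_p43 a ha
    · exact certified12_p9_p44 a ha
    · exact certified12_p9_p45 a ha
    · exact certified12_p9_p46 a ha
  · rw [mem_censusSearch_succ_iff, (by decide : nodeLo T12 [10] = 44),
      (by decide : nodeHi T12 [10] = 56)] at ha
    obtain ⟨a2, ha2, ha⟩ := ha
    simp only [List.cons_append, List.nil_append] at ha
    rw [mem_icc] at ha2
    obtain ⟨hlo2, hhi2⟩ := ha2
    interval_cases a2
    · exact certified12_p10_p44 a ha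
    · exact certified12_p10_p45 a ha
    · exact certified12_p10_p46 a ha
    · exact certified12_p10_p47 a ha
    · exact certified12_p10_p48 a ha
    · exact certified12_p10_p49 a ha
    · exact certified12_p10_p50 a ha
    · exact certified12_p10_p51 a ha
    · exact certified12_p10_p52 a ha
    · exact certified12_p10_p53 a ha
    · exact certified12_p10_p54 a ha
    · exact certified12_p10_p55 a ha
    · exact certified12_p10_p56 a ha
  · rw [mem_censusSearch_succ_iff, (by decide : nodeLo T12 [11] = 55),
      (by decide : nodeHi T12 [11] = 66)] at ha
    obtain ⟨a2, ha2, ha⟩ := ha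
    simp only [List.cons_append, List.nil_append] at ha
    rw [mem_icc] at ha2
    obtain ⟨hlo2, hhi2⟩ := ha2
    interval_cases a2
    · exact certified12_p11_p55 a ha
    · exact certified12_p11_p56 a ha
    · exact certified12_p11_p57 a ha
    · exact certified12_p11_p58 a ha
    · exact certified12_p11_p59 a ha
    · exact certified12_p11_p60 a ha
    · exact certified12_p11_p61 a ha
    · exact certified12_p11_p62 a ha
    · exact certified12_p11_p63 a ha
    · exact certified12_p11_p64 a ha
    · exact certified12_p11_p65 a ha
    · exact certified12_p11_p66 a ha
  · rw [mem_censusSearch_succ_iff, (by decide : nodeLo T12 [12] = 66),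
      (by decide : nodeHi T12 [12] = 78)] at ha
    obtain ⟨a2, ha2, ha⟩ := ha
    simp only [List.cons_append, List.nil_append] at ha
    rw [mem_icc] at ha2
    obtain ⟨hlo2, hhi2⟩ := ha2
    interval_cases a2
    · exact certified12_p12_p66 a ha
    · exact certified12_p12_p67 a ha
    · exact certified12_p12_p68 a ha
    · exact certified12_p12_p69 a ha
    · exact certified12_p12_p70 a ha
    · exact certified12_p12_p71 a ha
    · exact certified12_p12_p72 a ha
    · exact certified12_p12_p73 a ha
    · exact certified12_p12_p74 a ha
    · exact certified12_p12_p75 a ha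
    · exact certified12_p12_p76 a ha
    · exact certified12_p12_p77 a ha
    · exact certified12_p12_p78 a ha

/-- **Degree-12 census below `13/10` (kernel theorem):** `DegreeCensus 12 (13/10) coresDeg12` — every irreducible
`P ∈ ℤ[X]` of degree `12` with `1 < M(P) < 1.3` is `± c(± x)` for one of the 5 listed cores. -/
theorem degreeCensus_twelve : DegreeCensus 12 (13 / 10) coresDeg12 := by
  have h := degreeCensus_of_certified_nonneg (Bn := 13) (Bd := 10) (d := 6) (by norm_num) (by norm_num) (by decide)
    thresholdsValid_T12 (by have := smythTheta_gt; push_cast; linarith) certified12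
  norm_num at h
  exact h

end Summit.Ventures.DiscreteObjects.Mahler
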